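import Literature.AlgebraicGeometry.Motives.HodgeLieRigidityTraceCriterion
import Literature.AlgebraicGeometry.Motives.HodgeLieRigidDuplicateSummand
import Literature.AlgebraicGeometry.Motives.HodgeLieSemisimpleTimesAbelian
import HarnessLib

/-!
# `Θ`-rigidity of a direct sum `H ≅ H₁ ⊕ H₂` from `Θ`-rigidity of the summands, when the central `Θ`-traces of the two summands are
# `ℚ`-disjoint; in particular `H₁` rigid and `𝔷(𝔥(H₂)) = 0` ⟹ `H₁ ⊕ H₂` rigid (the trace criterion, blockwise)

Family `hodge`, layer `Literature/AlgebraicGeometry/Motives`.  THEOREMS ONLY (no definition, no named fact).  Written for the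
cell `pub-hodgecm2` (COR-CM), seat `b27` gen 54 (count-neutral Mumford–Tate-rank ladder, «rigidity modulo the centre», part 8).

`H ≅ H₁ ⊕ H₂` (morphisms `ι₁, π₁, ι₂, π₂`, `π_i ι_i = id`, `ι₁π₁ + ι₂π₂ = id`), all three polarizable, any weight.  A central element
`c ∈ 𝔷(𝔥(H)) = 𝔥(H) ∩ End_Hdg(H)` is block diagonal with blocks `c_i = π_i c ι_i ∈ 𝔷(𝔥(H_i))` (`eq_sum_blocks_of_mem_hodgeLie`,
`comp_mem_hodgeLie_of_retract`), and `tr(c_ℂ Θ) = tr(c_{1,ℂ} Θ₁) + tr(c_{2,ℂ} Θ₂)` (`Θ_i = π_i Θ ι_i`, `restrict_theta_apply`).  By the exact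
criterion (`Motives/HodgeLieRigidityTraceCriterion`: rigid ⟺ no non-zero central `c` with `tr(c_ℂΘ) = 0`):
* **`rigid_of_rigid_summands_of_trace_disjoint`** — `H₁`, `H₂` `Θ`-rigid and «`tr(c_{1,ℂ}Θ₁) + tr(c_{2,ℂ}Θ₂) = 0 ⟹ tr(c_{1,ℂ}Θ₁) = 0`» for
  all central `c_i` (the `ℚ`-spaces of central `Θ`-traces of `H₁` and `H₂` meet in `0`) ⟹ `H` is `Θ`-rigid;
* **`rigid_of_rigid_of_center_eq_bot`** — `H₁` `Θ`-rigid and `𝔥(H₂) ∩ End_Hdg(H₂) = 0` ⟹ `H` `Θ`-rigid.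
(E.g. `H¹(X × Y)` for `X` with `Θ`-rigid `H¹` and `Y` without factors of type IV; or two type-IV blocks with central traces in `i√d₁ℚ`, `i√d₂ℚ`,
`d₁/d₂ ∉ (ℚ^×)²` — `CorCM/MumfordTateRankQuadraticEndPairsRigid`.)

## References
* [MoonenZarhin1999LowDim] B. Moonen, Yu. G. Zarhin, Math. Ann. 315 (1999), §3 (3.1), Prop. (3.8) [corpus: paper:arxiv-math_9901113 pp. 6–7].
  [cite: MoonenZarhin1999LowDim, §3 (3.1)]
* [Deligne1982HodgeCycles] P. Deligne, LNM 900 (1982), I §3 Prop. 3.6. [cite: Deligne1982HodgeCycles, I §3 Prop. 3.6]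
-/

noncomputable section

open scoped TensorProduct

namespace Literature.AlgebraicGeometry.Motives

namespace HodgeStructure

universe u

variable {V₁ : Type u} [AddCommGroup V₁] [Module ℚ V₁] [Module.Finite ℚ V₁]
  {V₂ : Type u} [AddCommGroup V₂] [Module ℚ V₂] [Module.Finite ℚ V₂]
  {V : Type u} [AddCommGroup V] [Module ℚ V] [Module.Finite ℚ V] [HodgeTensorFacts.{u, u}] {n : ℤ}
  {H₁ : HodgeStructure V₁ n} {H₂ : HodgeStructure V₂ n} {H : HodgeStructure V n}
  (ι₁ : Hom H₁ H) (π₁ : Hom H H₁) (ι₂ : Hom H₂ H) (π₂ : Hom H H₂)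
  (hπι₁ : ∀ v, π₁.toLinearMap (ι₁.toLinearMap v) = v) (hπι₂ : ∀ v, π₂.toLinearMap (ι₂.toLinearMap v) = v)
  (hsum : ∀ v, ι₁.toLinearMap (π₁.toLinearMap v) + ι₂.toLinearMap (π₂.toLinearMap v) = v)

omit [HodgeTensorFacts.{u, u}] in
/-- **Block trace**: `tr((ι₁ c₁ π₁)_ℂ Θ) = tr(c_{1,ℂ} (π₁ Θ ι₁))`. [cite: Deligne1982HodgeCycles, I §3 Prop. 3.6] -/
theorem trace_baseChange_incl_comp_proj_mul (c₁ : Module.End ℚ V₁) (Θ : Module.End ℂ (ℂ ⊗[ℚ] V)) :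
    LinearMap.trace ℂ _ ((ι₁.toLinearMap ∘ₗ c₁ ∘ₗ π₁.toLinearMap).baseChange ℂ * Θ) =
      LinearMap.trace ℂ _ (c₁.baseChange ℂ * (π₁.toLinearMap.baseChange ℂ ∘ₗ Θ ∘ₗ ι₁.toLinearMap.baseChange ℂ)) := by
  have e1 : (ι₁.toLinearMap ∘ₗ c₁ ∘ₗ π₁.toLinearMap).baseChange ℂ * Θ =
      ι₁.toLinearMap.baseChange ℂ ∘ₗ (c₁.baseChange ℂ ∘ₗ π₁.toLinearMap.baseChange ℂ ∘ₗ Θ) := by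
    rw [LinearMap.baseChange_comp, LinearMap.baseChange_comp]; rfl
  have e2 : (c₁.baseChange ℂ ∘ₗ π₁.toLinearMap.baseChange ℂ ∘ₗ Θ) ∘ₗ ι₁.toLinearMap.baseChange ℂ =
      c₁.baseChange ℂ * (π₁.toLinearMap.baseChange ℂ ∘ₗ Θ ∘ₗ ι₁.toLinearMap.baseChange ℂ) := rfl
  rw [e1, LinearMap.trace_comp_comm', e2]

include hπι₁ hπι₂ hsum in
/-- **The blocks of a central element are central**: for `c ∈ 𝔥(H) ∩ End_Hdg(H)`, `c = ι₁c₁π₁ + ι₂c₂π₂` with `c_i = π_i c ι_i ∈ 𝔥(H_i) ∩ End_Hdg(H_i)`.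
[cite: MoonenZarhin1999LowDim, §3 (3.1)] [cite: Deligne1982HodgeCycles, I §3 Prop. 3.6] -/
theorem center_blocks {c : Module.End ℚ V} (hc : c ∈ H.hodgeLie ⊓ Subalgebra.toSubmodule H.endAlg) :
    c = ι₁.toLinearMap ∘ₗ (π₁.toLinearMap ∘ₗ c ∘ₗ ι₁.toLinearMap) ∘ₗ π₁.toLinearMap +
        ι₂.toLinearMap ∘ₗ (π₂.toLinearMap ∘ₗ c ∘ₗ ι₂.toLinearMap) ∘ₗ π₂.toLinearMap ∧
      π₁.toLinearMap ∘ₗ c ∘ₗ ι₁.toLinearMap ∈ H₁.hodgeLie ⊓ Subalgebra.toSubmodule H₁.endAlg ∧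
      π₂.toLinearMap ∘ₗ c ∘ₗ ι₂.toLinearMap ∈ H₂.hodgeLie ⊓ Subalgebra.toSubmodule H₂.endAlg := by
  obtain ⟨hc𝔥, hcE⟩ := Submodule.mem_inf.1 hc
  rw [Subalgebra.mem_toSubmodule] at hcE
  refine ⟨eq_sum_blocks_of_mem_hodgeLie ι₁ π₁ ι₂ π₂ hπι₁ hπι₂ hsum hc𝔥, ?_, ?_⟩
  · exact Submodule.mem_inf.2 ⟨comp_mem_hodgeLie_of_retract ι₁ π₁ hπι₁ hc𝔥, ((π₁.comp (endAlg.toHom ⟨c, hcE⟩)).comp ι₁).toLinearMap_mem_endAlg⟩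
  · exact Submodule.mem_inf.2 ⟨comp_mem_hodgeLie_of_retract ι₂ π₂ hπι₂ hc𝔥, ((π₂.comp (endAlg.toHom ⟨c, hcE⟩)).comp ι₂).toLinearMap_mem_endAlg⟩

include hπι₁ hπι₂ hsum in
/-- **`Θ`-rigidity of `H₁ ⊕ H₂` from `Θ`-rigidity of the summands and `ℚ`-disjointness of their central `Θ`-traces** (module docstring).
[cite: MoonenZarhin1999LowDim, §3 (3.1)] [cite: Deligne1982HodgeCycles, I §3 Prop. 3.6] -/
theorem rigid_of_rigid_summands_of_trace_disjoint (ψ : H.Polarization) (hH₁ : H₁.IsPolarizable) (hH₂ : H₂.IsPolarizable)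
    (hrig₁ : ∀ 𝔟 : Submodule ℚ (Module.End ℚ V₁), 𝔟 ≤ H₁.hodgeLie →
      (∀ X ∈ 𝔟, ∀ Y ∈ 𝔟, X * Y - Y * X ∈ 𝔟) →
      (∃ Θ ∈ Submodule.span ℂ ((fun X : Module.End ℚ V₁ => X.baseChange ℂ) '' (𝔟 : Set (Module.End ℚ V₁))),
        ∀ p, ∀ x ∈ H₁.piece p (n - p), Θ x = ((2 * p - n : ℤ) : ℂ) • x) → H₁.hodgeLie ≤ 𝔟)
    (hrig₂ : ∀ 𝔟 : Submodule ℚ (Module.End ℚ V₂), 𝔟 ≤ H₂.hodgeLie →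
      (∀ X ∈ 𝔟, ∀ Y ∈ 𝔟, X * Y - Y * X ∈ 𝔟) →
      (∃ Θ ∈ Submodule.span ℂ ((fun X : Module.End ℚ V₂ => X.baseChange ℂ) '' (𝔟 : Set (Module.End ℚ V₂))),
        ∀ p, ∀ x ∈ H₂.piece p (n - p), Θ x = ((2 * p - n : ℤ) : ℂ) • x) → H₂.hodgeLie ≤ 𝔟)
    {Θ₁ : Module.End ℂ (ℂ ⊗[ℚ] V₁)} (hΘ₁ : ∀ p, ∀ x ∈ H₁.piece p (n - p), Θ₁ x = ((2 * p - n : ℤ) : ℂ) • x)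
    {Θ₂ : Module.End ℂ (ℂ ⊗[ℚ] V₂)} (hΘ₂ : ∀ p, ∀ x ∈ H₂.piece p (n - p), Θ₂ x = ((2 * p - n : ℤ) : ℂ) • x)
    (hdisj : ∀ c₁ ∈ H₁.hodgeLie ⊓ Subalgebra.toSubmodule H₁.endAlg, ∀ c₂ ∈ H₂.hodgeLie ⊓ Subalgebra.toSubmodule H₂.endAlg,
      LinearMap.trace ℂ _ (c₁.baseChange ℂ * Θ₁) + LinearMap.trace ℂ _ (c₂.baseChange ℂ * Θ₂) = 0 →
        LinearMap.trace ℂ _ (c₁.baseChange ℂ * Θ₁) = 0) :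
    ∀ 𝔞 : Submodule ℚ (Module.End ℚ V), 𝔞 ≤ H.hodgeLie →
      (∀ X ∈ 𝔞, ∀ Y ∈ 𝔞, X * Y - Y * X ∈ 𝔞) →
      (∃ Θ ∈ Submodule.span ℂ ((fun X : Module.End ℚ V => X.baseChange ℂ) '' (𝔞 : Set (Module.End ℚ V))),
        ∀ p, ∀ x ∈ H.piece p (n - p), Θ x = ((2 * p - n : ℤ) : ℂ) • x) → H.hodgeLie ≤ 𝔞 := by
  classical
  obtain ⟨Θ₀, hΘ₀⟩ := exists_hodgeTheta H
  -- the restricted Hodge operators coincide with the given ones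
  have hΘ₁' := restrict_theta_apply ι₁ π₁ hπι₁ Θ₀ hΘ₀
  have hΘ₂' := restrict_theta_apply ι₂ π₂ hπι₂ Θ₀ hΘ₀
  have e₁ : π₁.toLinearMap.baseChange ℂ ∘ₗ Θ₀ ∘ₗ ι₁.toLinearMap.baseChange ℂ = Θ₁ :=
    linearMap_ext_of_piece H₁ fun p x hx => by rw [hΘ₁' p x hx, hΘ₁ p x hx]
  have e₂ : π₂.toLinearMap.baseChange ℂ ∘ₗ Θ₀ ∘ₗ ι₂.toLinearMap.baseChange ℂ = Θ₂ :=
    linearMap_ext_of_piece H₂ fun p x hx => by rw [hΘ₂' p x hx, hΘ₂ p x hx]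
  have hcrit₁ := (rigid_iff_forall_center_trace_theta H₁ hH₁ hΘ₁).1 hrig₁
  have hcrit₂ := (rigid_iff_forall_center_trace_theta H₂ hH₂ hΘ₂).1 hrig₂
  refine rigid_of_forall_center_trace_theta H ⟨ψ⟩ hΘ₀ fun c hc htr => ?_
  obtain ⟨hcdec, hc₁, hc₂⟩ := center_blocks ι₁ π₁ ι₂ π₂ hπι₁ hπι₂ hsum hc
  set c₁ := π₁.toLinearMap ∘ₗ c ∘ₗ ι₁.toLinearMap with hc₁def
  set c₂ := π₂.toLinearMap ∘ₗ c ∘ₗ ι₂.toLinearMap with hc₂def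
  have htr' : LinearMap.trace ℂ _ (c₁.baseChange ℂ * Θ₁) + LinearMap.trace ℂ _ (c₂.baseChange ℂ * Θ₂) = 0 := by
    rw [hcdec, LinearMap.baseChange_add, add_mul, map_add, trace_baseChange_incl_comp_proj_mul ι₁ π₁,
      trace_baseChange_incl_comp_proj_mul ι₂ π₂, e₁, e₂] at htr
    exact htr
  have h₁0 : LinearMap.trace ℂ _ (c₁.baseChange ℂ * Θ₁) = 0 := hdisj c₁ hc₁ c₂ hc₂ htr'
  have hc₁0 : c₁ = 0 := hcrit₁ c₁ hc₁ h₁0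
  have h₂0 : LinearMap.trace ℂ _ (c₂.baseChange ℂ * Θ₂) = 0 := by rw [h₁0, zero_add] at htr'; exact htr'
  have hc₂0 : c₂ = 0 := hcrit₂ c₂ hc₂ h₂0
  rw [hcdec, hc₁0, hc₂0]
  simp only [LinearMap.comp_zero, LinearMap.zero_comp, add_zero]

include hπι₁ hπι₂ hsum in
/-- **`H₁` `Θ`-rigid and `𝔥(H₂) ∩ End_Hdg(H₂) = 0` ⟹ `H₁ ⊕ H₂` `Θ`-rigid** (the central traces of `H₂` vanish; `H₂` is itself rigid by
`rigid_of_center_eq_bot`). [cite: MoonenZarhin1999LowDim, §3 (3.1)] [cite: Deligne1982HodgeCycles, I §3 Prop. 3.6] -/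
theorem rigid_of_rigid_of_center_eq_bot (ψ : H.Polarization) (hH₁ : H₁.IsPolarizable) (hH₂ : H₂.IsPolarizable)
    (hrig₁ : ∀ 𝔟 : Submodule ℚ (Module.End ℚ V₁), 𝔟 ≤ H₁.hodgeLie →
      (∀ X ∈ 𝔟, ∀ Y ∈ 𝔟, X * Y - Y * X ∈ 𝔟) →
      (∃ Θ ∈ Submodule.span ℂ ((fun X : Module.End ℚ V₁ => X.baseChange ℂ) '' (𝔟 : Set (Module.End ℚ V₁))),
        ∀ p, ∀ x ∈ H₁.piece p (n - p), Θ x = ((2 * p - n : ℤ) : ℂ) • x) → H₁.hodgeLie ≤ 𝔟)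
    (h𝔷₂ : H₂.hodgeLie ⊓ Subalgebra.toSubmodule H₂.endAlg = ⊥) :
    ∀ 𝔞 : Submodule ℚ (Module.End ℚ V), 𝔞 ≤ H.hodgeLie →
      (∀ X ∈ 𝔞, ∀ Y ∈ 𝔞, X * Y - Y * X ∈ 𝔞) →
      (∃ Θ ∈ Submodule.span ℂ ((fun X : Module.End ℚ V => X.baseChange ℂ) '' (𝔞 : Set (Module.End ℚ V))),
        ∀ p, ∀ x ∈ H.piece p (n - p), Θ x = ((2 * p - n : ℤ) : ℂ) • x) → H.hodgeLie ≤ 𝔞 := by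
  obtain ⟨Θ₁, hΘ₁⟩ := exists_hodgeTheta H₁
  obtain ⟨Θ₂, hΘ₂⟩ := exists_hodgeTheta H₂
  refine rigid_of_rigid_summands_of_trace_disjoint ι₁ π₁ ι₂ π₂ hπι₁ hπι₂ hsum ψ hH₁ hH₂ hrig₁ (rigid_of_center_eq_bot H₂ hH₂ h𝔷₂) hΘ₁ hΘ₂
    fun c₁ _ c₂ hc₂ h => ?_
  rw [h𝔷₂, Submodule.mem_bot] at hc₂
  rw [hc₂, LinearMap.baseChange_zero, zero_mul, map_zero, add_zero] at h
  exact h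

end HodgeStructure

end Literature.AlgebraicGeometry.Motives

end
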